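import Mathlib
import HarnessLib

/-!
# Type-I main term for Bateman–Horn (stmt-Parity-0873), input C (part 2):
# convolution with an absolutely convergent factor

* `tendsto_sum_mul_of_summable` — if `∑ |e(n)| < ∞` and the partial sums of `F` are
  `Φ + O(K/(1 + log N))`, then `∑_{n ≤ N} (e ⋆ F)(n) → (∑_n e(n)) Φ`
  (`∑_{n ≤ N} (e ⋆ F)(n) = ∑_{m ≤ N} e(m) 𝔉(N/m)`; split at `m ≤ √N`).

Everything here is proved. [folklore]
-/

noncomputable section

open Finset ArithmeticFunction Filter Topology

namespace Summit.Parity.BatemanHorn.Theorems.TypeIMainTerm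

/-- `∑_{n ∈ Ioc 0 N} e(n) = ∑_{n < N+1} e(n)` for an arithmetic function (`e(0) = 0`). -/
theorem sum_Ioc_eq_sum_range (e : ArithmeticFunction ℝ) (N : ℕ) :
    ∑ n ∈ Ioc 0 N, e n = ∑ n ∈ Finset.range (N + 1), e n := by
  have h : Finset.range (N + 1) = insert 0 (Ioc 0 N) := by
    ext n; simp only [Finset.mem_range, Finset.mem_insert, Finset.mem_Ioc]; omega
  rw [h, Finset.sum_insert (by simp), ArithmeticFunction.map_zero, zero_add]

/-- **Convolution with an absolutely convergent factor.** If `∑_n |e(n)| < ∞` and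
`|∑_{n ≤ N} F(n) − Φ| ≤ K/(1 + log N)` for all `N ≥ 1`, then
`∑_{n ≤ N} (e ⋆ F)(n) → (∑_n e(n)) · Φ` as `N → ∞`. [folklore] -/
theorem tendsto_sum_mul_of_summable (e F : ArithmeticFunction ℝ) {Φ K : ℝ} (hK : 0 ≤ K)
    (he : Summable (fun n => |e n|))
    (hF : ∀ N : ℕ, 1 ≤ N → |∑ n ∈ Ioc 0 N, F n - Φ| ≤ K / (1 + Real.log N)) :
    Tendsto (fun N : ℕ => ∑ n ∈ Ioc 0 N, (e * F) n) atTop (𝓝 ((∑' n, e n) * Φ)) := by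
  have he' : Summable (fun n => e n) := he.of_abs
  set T : ℝ := ∑' n, |e n| with hT
  have hT0 : 0 ≤ T := tsum_nonneg fun n => abs_nonneg _
  -- decomposition `∑ (e ⋆ F) = Φ ∑_{m ≤ N} e(m) + ∑_{m ≤ N} e(m) (𝔉(N/m) − Φ)`
  have hdec : ∀ N : ℕ, ∑ n ∈ Ioc 0 N, (e * F) n =
      Φ * ∑ m ∈ Ioc 0 N, e m + ∑ m ∈ Ioc 0 N, e m * (∑ n ∈ Ioc 0 (N / m), F n - Φ) := by
    intro N
    rw [sum_Ioc_mul_eq_sum_sum, Finset.mul_sum, ← Finset.sum_add_distrib]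
    exact Finset.sum_congr rfl fun m _ => by ring
  -- the main term
  have hmain : Tendsto (fun N : ℕ => Φ * ∑ m ∈ Ioc 0 N, e m) atTop (𝓝 (Φ * ∑' n, e n)) := by
    refine Tendsto.const_mul Φ ?_
    have h1 := he'.hasSum.tendsto_sum_nat
    have h2 : Tendsto (fun N : ℕ => ∑ n ∈ Finset.range (N + 1), e n) atTop (𝓝 (∑' n, e n)) :=
      h1.comp (tendsto_add_atTop_nat 1)
    exact h2.congr fun N => (sum_Ioc_eq_sum_range e N).symm
  -- the error term tends to zero
  have herr : Tendsto (fun N : ℕ => ∑ m ∈ Ioc 0 N, e m * (∑ n ∈ Ioc 0 (N / m), F n - Φ))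
      atTop (𝓝 0) := by
    -- tail sums of `|e|`
    set tail : ℕ → ℝ := fun z => ∑' n, |e (n + (z + 1))| with htail
    have htail0 : Tendsto tail atTop (𝓝 0) := by
      have h1 : Tendsto (fun z : ℕ => ∑' n, |e (n + z)|) atTop (𝓝 0) :=
        tendsto_sum_nat_add fun n => |e n|
      exact h1.comp (tendsto_add_atTop_nat 1)
    have htail_eq : ∀ z : ℕ, tail z = T - ∑ m ∈ Finset.range (z + 1), |e m| := by
      intro z
      have := he.sum_add_tsum_nat_add (z + 1)
      simp only [htail, hT]
      linarith
    have htail_ge : ∀ z N : ℕ, z ≤ N → ∑ m ∈ Ioc z N, |e m| ≤ tail z := by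
      intro z N hzN
      rw [htail_eq, ← Finset.Ico_add_one_add_one_eq_Ioc, Finset.sum_Ico_eq_sub _ (by omega)]
      have : ∑ m ∈ Finset.range (N + 1), |e m| ≤ T := he.sum_le_tsum _ (fun n _ => abs_nonneg _)
      linarith
    -- the bound `b N = 4 K T/(1 + log N) + K · tail(√N)`
    set b : ℕ → ℝ := fun N => 4 * K * T / (1 + Real.log N) + K * tail (Nat.sqrt N) with hb
    have hb0 : Tendsto b atTop (𝓝 0) := by
      have h1 : Tendsto (fun N : ℕ => 4 * K * T / (1 + Real.log N)) atTop (𝓝 0) := by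
        refine Tendsto.div_atTop tendsto_const_nhds ?_
        exact tendsto_atTop_add_const_left _ 1 (Real.tendsto_log_atTop.comp tendsto_natCast_atTop_atTop)
      have h2 : Tendsto (fun N : ℕ => K * tail (Nat.sqrt N)) atTop (𝓝 (K * 0)) :=
        Tendsto.const_mul K (htail0.comp (by
          refine tendsto_atTop_atTop.mpr fun z => ⟨z * z, fun N hN => ?_⟩
          exact Nat.le_sqrt.mpr hN))
      rw [mul_zero] at h2
      simpa using h1.add h2
    refine squeeze_zero_norm' ?_ hb0
    filter_upwards [eventually_ge_atTop 1] with N hN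
    rw [Real.norm_eq_abs]
    set z := Nat.sqrt N with hz
    have hz1 : 1 ≤ z := Nat.le_sqrt.mpr (by simpa using hN)
    have hzN : z ≤ N := Nat.sqrt_le_self N
    have hzz : z ≤ N / z := (Nat.le_div_iff_mul_le (by omega)).mpr (Nat.sqrt_le N)
    have hℓ1 : 1 ≤ 1 + Real.log N := by
      have : 0 ≤ Real.log N := Real.log_nonneg (by exact_mod_cast hN); linarith
    -- `1 + log N ≤ 4 (1 + log z)` and the pointwise bounds
    have hlog4 : 1 + Real.log N ≤ 4 * (1 + Real.log z) := by
      have hlt : N < (z + 1) * (z + 1) := Nat.lt_succ_sqrt N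
      have hz1' : (1 : ℝ) ≤ z := by exact_mod_cast hz1
      have h4 : (N : ℝ) ≤ 4 * (z : ℝ) ^ 2 := by
        have h1 : (N : ℝ) ≤ ((z : ℝ) + 1) ^ 2 := by exact_mod_cast (by nlinarith : N ≤ (z + 1) ^ 2)
        nlinarith
      have hlog : Real.log N ≤ Real.log 4 + 2 * Real.log z := by
        calc Real.log N ≤ Real.log (4 * (z : ℝ) ^ 2) := Real.log_le_log (by exact_mod_cast hN) h4
          _ = Real.log 4 + 2 * Real.log z := by
              rw [Real.log_mul (by norm_num) (by positivity), Real.log_pow]; push_cast; ring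
      have hlog4' : Real.log 4 ≤ 3 := by
        have := Real.log_le_sub_one_of_pos (by norm_num : (0 : ℝ) < 4); linarith
      have hlogz : 0 ≤ Real.log z := Real.log_nonneg hz1'
      linarith
    have hsmall : ∀ m ∈ Ioc 0 z, |e m * (∑ n ∈ Ioc 0 (N / m), F n - Φ)| ≤
        |e m| * (4 * K / (1 + Real.log N)) := by
      intro m hm
      obtain ⟨hm0, hmz⟩ := Finset.mem_Ioc.mp hm
      rw [abs_mul]
      refine mul_le_mul_of_nonneg_left ?_ (abs_nonneg _)
      have hzm : z ≤ N / m := hzz.trans (Nat.div_le_div_left hmz hm0)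
      have h1m : 1 ≤ N / m := hz1.trans hzm
      refine (hF (N / m) h1m).trans ?_
      have hlogNm : 0 ≤ Real.log ((N / m : ℕ) : ℝ) := Real.log_nonneg (by exact_mod_cast h1m)
      have hzlog : Real.log z ≤ Real.log ((N / m : ℕ) : ℝ) :=
        Real.log_le_log (by exact_mod_cast hz1) (by exact_mod_cast hzm)
      rw [div_le_div_iff₀ (by linarith) (by linarith)]
      nlinarith
    have hlarge : ∀ m ∈ Ioc z N, |e m * (∑ n ∈ Ioc 0 (N / m), F n - Φ)| ≤ |e m| * K := by
      intro m hm
      obtain ⟨hmz, hmN⟩ := Finset.mem_Ioc.mp hm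
      rw [abs_mul]
      refine mul_le_mul_of_nonneg_left ?_ (abs_nonneg _)
      have h1m : 1 ≤ N / m := (Nat.le_div_iff_mul_le (by omega)).mpr (by simpa using hmN)
      refine (hF (N / m) h1m).trans (div_le_self hK ?_)
      have : 0 ≤ Real.log ((N / m : ℕ) : ℝ) := Real.log_nonneg (by exact_mod_cast h1m)
      linarith
    calc |∑ m ∈ Ioc 0 N, e m * (∑ n ∈ Ioc 0 (N / m), F n - Φ)|
        ≤ ∑ m ∈ Ioc 0 N, |e m * (∑ n ∈ Ioc 0 (N / m), F n - Φ)| := Finset.abs_sum_le_sum_abs _ _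
      _ = ∑ m ∈ Ioc 0 z, |e m * (∑ n ∈ Ioc 0 (N / m), F n - Φ)| +
            ∑ m ∈ Ioc z N, |e m * (∑ n ∈ Ioc 0 (N / m), F n - Φ)| :=
          (Finset.sum_Ioc_consecutive _ (Nat.zero_le z) hzN).symm
      _ ≤ ∑ m ∈ Ioc 0 z, |e m| * (4 * K / (1 + Real.log N)) + ∑ m ∈ Ioc z N, |e m| * K :=
          add_le_add (Finset.sum_le_sum hsmall) (Finset.sum_le_sum hlarge)
      _ = (∑ m ∈ Ioc 0 z, |e m|) * (4 * K / (1 + Real.log N)) + (∑ m ∈ Ioc z N, |e m|) * K := by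
          rw [Finset.sum_mul, Finset.sum_mul]
      _ ≤ T * (4 * K / (1 + Real.log N)) + tail z * K := by
          refine add_le_add (mul_le_mul_of_nonneg_right ?_ (by positivity))
            (mul_le_mul_of_nonneg_right (htail_ge z N hzN) hK)
          exact he.sum_le_tsum _ fun n _ => abs_nonneg _
      _ = b N := by simp only [hb]; ring
  have := hmain.add herr
  rw [add_zero, mul_comm] at this
  exact this.congr fun N => (hdec N).symm

end Summit.Parity.BatemanHorn.Theorems.TypeIMainTerm

end
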